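import Summits.QuantumFields.BalabanUV.Beta.GAN24.CouplingWordsAtCoupling

/-!
# `BalabanUV.Beta.GAN24.CouplingWordsAtCouplingDecay` — binder row G-an2-4 ∕ (CONV-C), route R7 «TWO CURRENCIES», PART 262: (UD)+(SR) OF EVERY WORD IN COUPLING LETTERS AT A
# BASE POINT, VOLUME-FREE AND `u`-UNIFORM ON THE BASE LETTER's DISC.  `X_{w,k}(u) = L^{dk}Q_k(𝒢_k(u)A_{i₁,k}𝒢_k(u)⋯𝒢_k(u))Q_kᴴ`, `𝒢_k(u) = (Δ_a^{(k)} + u·A₀^{(k)})⁻¹`, where the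
# BASE letter `A₀ = P(U₁) + P(U₂)ᴴ + diag Z` is a coupling letter with SMALL constants `(α₀, β₀, α₀′, β₀′)` (its Neumann disc `‖u‖ ≤ T`: `Tκ₀ ≤ 1∕2`, `Tκ_c ≤ 1∕2`) and the
# inserted letters `A_i = P(V₁ᵢ) + P(V₂ᵢ)ᴴ + diag Wᵢ` are coupling letters with ARBITRARY common constants `(α, β, α′, β′)` — the class of the exact abelian covariant Laplacian
# `Δ^U − Δ^1` (NE2's `covPert_eq`).  These are the letters of the Taylor coefficients of the effective form at the base point `u·A₀` (e.g. the one-loop Hessian at a NONZERO small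
# background `U₀`, base letter `Δ^{U₀} − Δ^1` at `u = 1`): PART 237 §2 is `u = 0`, PART 162 the first-order chains `(𝒢(u)P)^n𝒢(u)`; here every word, by PART 261's
# `towerLimitRate_word_at_coupling` (Neumann factors `≤ 2` on the disc) + PART 261's conjugated word bound at the base point + PART 126's dictionary, joined by
# `decayRate_of_towerLimitRate` (unit b2b-balaban-gan24-p3, gen 67; v1)

NOT IN PRINT; OUR PROOF ([folklore] bookkeeping BY NAME over PART 261 (`towerLimitRate_word_at_coupling`, `opNorm_conjMat_wordAt_le`), PART 236 (`perturbationLaws_couplingLetter`,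
`hPc_couplingLetter`), PART 162 (`neumann_factor_le_two`, `towerLimitRate_mono`), PART 126 (`hdecB_of_conjBound`), PART 124 (`conjDefect_calDalev_rho`, `max_JA_lt_gamD`), NE2's
`freeTowerLaws_balaban`, `wCoercive_calDa_of_conjDefect`, `decayRate_of_towerLimitRate`, `entryDecay_of_le_rate ∕ entryDecay_add`; [Balaban1984PropagatorsI] Prop. 1.1 (1.89) p. 33
LOCATES the decay of `G` (the object); nothing printed is a hypothesis).
HONEST FRAMING (cell contract, verbatim): «discharging `BetaPertH` makes Bałaban's UV stability UNCONDITIONAL — a real constructive-QFT result; it is NOT the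
continuum limit and NOT the Clay problem.»  HONEST DEPENDENCY (verbatim): «continuum YM on T⁴ ⇐ BetaPertH ∧ nine spine estimates (0/9 proved); BetaPertH ⇐
(D1) ∧ (D4) ∧ CAP+tail; G-an2-4 gates asym, D1 and NE2/3/4.»

WHAT THIS FILE PROVES (0 sorry, 0 `def`; `L ≥ 2`, `d ≥ 1`, nonnegative constants, admissible `(a′, κ)`, `T ≥ 0` with `Tκ₀ ≤ 1∕2`, `Tκ_c ≤ 1∕2` in the base letter's constants;
`κ₀ = 2d(α₀+β₀)Cst + α₀′Cst`, `κ_c` = PART 236's conjugated constant at `(α₀, β₀, α₀′)`):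
* **`couplingWordAt_decay_inputs`** (every word `w`): `∃ κ₁ > 0, B, B′ ≥ 0` from `(d, L, a, a′, κ, T, α₀, β₀, α₀′, β₀′, α, β, α′, β′, |w|)` such that for EVERY torus `M`, EVERY base
  letter ∕ family with those constants and EVERY `‖u‖ ≤ T`: (UD) `EntryDecay distK (X_{w,k}(u)) B κ₁` ∀ `k`, (SR) `TwoLevelDecayRate distK X_w(u) B′ κ₁ (√(L⁻¹))`.
WHAT IT DOES NOT DO: EL₂ of `X_w(u)` and the INPUT triple (the next PART); couplings outside the disc; colour.  SUPPLIER work; NEVER «G-an2-4 closed»; NOT (CONV-C), NOT D1, NOT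
`BetaPertH`, NOT continuum, NOT Clay.  Records: `HOME/b2b-balaban-gan24-p3/gen67/README.md`.
-/

noncomputable section

open scoped BigOperators ComplexConjugate Matrix Matrix.Norms.L2Operator
open Filter Topology

namespace Summit.QuantumFields.BalabanUV.Beta.GAN24.CouplingWordsAtCouplingDecay

open Literature.MathematicalPhysics.QuantumFieldTheory.Balaban1983to89
open Literature.MathematicalPhysics.QuantumFieldTheory.Balaban1983to89.B5Prop11Plancherel (Tor fine Cst Cst_nonneg)
open Literature.MathematicalPhysics.QuantumFieldTheory.Balaban1983to89.B5G183RateUnitTower (lev)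
open Summit.QuantumFields.BalabanUV.T4Continuum
open Summit.QuantumFields.BalabanUV.T4Continuum.CovariantAveragingTower (avgTow TowerLimitRate)
open Summit.QuantumFields.BalabanUV.T4Continuum.BalabanAveragedTowerUnit (idx QBlev calGlev one_le_lev')
open Summit.QuantumFields.BalabanUV.T4Continuum.BalabanAveragingPairing (freeTowerLaws_balaban)
open Summit.QuantumFields.BalabanUV.T4Continuum.KingPairingPlantedLaw (calDalev CJ CJ_nonneg)
open Summit.QuantumFields.BalabanUV.T4Continuum.FirstOrderBackgroundModel (LipschitzBackground Pmodel C2model)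
open Summit.QuantumFields.BalabanUV.T4Continuum.FirstOrderAdjointModel (C2adj C2adj_nonneg)
open Summit.QuantumFields.BalabanUV.T4Continuum.PerturbationAlgebra (BoundedBackground)
open Summit.QuantumFields.BalabanUV.T4Continuum.CTWeightedCoercivity (conjMat WCoercive)
open Summit.QuantumFields.BalabanUV.T4Continuum.CTKingTowerWeights (rho distK)
open Summit.QuantumFields.BalabanUV.T4Continuum.CTConjugatedHbd (G2 G2_nonneg wCoercive_calDa_of_conjDefect)
open Summit.QuantumFields.BalabanUV.T4Continuum.CTConjDefectDischarge (conjDefect_calDalev_rho max_JA_lt_gamD)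
open Summit.QuantumFields.BalabanUV.T4Continuum.DirichletRegionTower (gamD)
open Summit.QuantumFields.BalabanUV.T4Continuum.ScalarAveragedPropagator (gammaPs)
open Summit.QuantumFields.BalabanUV.T4Continuum.ScalarAveragedCompression (sigma0)
open Summit.QuantumFields.BalabanUV.T4Continuum.CTScalarGreen (Jfree)
open Summit.QuantumFields.BalabanUV.T4Continuum.CTGaugeTerm (deltaK)
open Summit.QuantumFields.BalabanUV.T4Continuum.CTVectorPropagator (JA)
open Summit.QuantumFields.BalabanUV.T4Continuum.DecayRateInterpolation (EntryDecay DecayRate TwoLevelDecayRate decayRate_of_towerLimitRate)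
open Summit.QuantumFields.BalabanUV.Beta.GAN24.DiagramDecayAlgebra (entryDecay_add)
open Summit.QuantumFields.BalabanUV.Beta.GAN24.UnitLatticeDecayAlgebra (distK_nonneg)
open Summit.QuantumFields.BalabanUV.Beta.GAN24.EffectiveFormDecay (entryDecay_of_le_rate)
open Summit.QuantumFields.BalabanUV.Beta.GAN24.InsertionChainDecayBalaban (hdecB_of_conjBound)
open Summit.QuantumFields.BalabanUV.Beta.GAN24.CouplingLetterStencil (perturbationLaws_couplingLetter hPc_couplingLetter)
open Summit.QuantumFields.BalabanUV.Beta.GAN24.PerturbedInsertionChainDecay (neumann_factor_le_two towerLimitRate_mono)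
open Summit.QuantumFields.BalabanUV.Beta.GAN24.CouplingWordsAtCoupling (towerLimitRate_word_at_coupling opNorm_conjMat_wordAt_le)

variable {d : ℕ} (L : ℕ) [NeZero L] (a : ℝ) (ha : 0 < a)

/-- **`couplingWordAt_decay_inputs` — (UD)+(SR) OF EVERY WORD IN COUPLING LETTERS AT A BASE POINT, VOLUME-FREE AND `u`-UNIFORM ON THE DISC** (`L ≥ 2`, `d ≥ 1`, every word
`w`): `∃ κ₁ > 0, B, B′ ≥ 0` such that for EVERY torus `M`, EVERY base letter `A₀ = P(U₁) + P(U₂)ᴴ + diag Z` (constants `(α₀, β₀, α₀′, β₀′)`), EVERY family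
`A_i = P(V₁ᵢ) + P(V₂ᵢ)ᴴ + diag Wᵢ` (constants `(α, β, α′, β′)`) and EVERY `‖u‖ ≤ T`: (UD) `EntryDecay distK (X_{w,k}(u)) B κ₁` ∀ `k` and (SR)
`TwoLevelDecayRate distK X_w(u) B′ κ₁ (√(L⁻¹))`, `X_{w,k}(u) = L^{dk}Q_k(𝒢_k(u)A_{i₁,k}𝒢_k(u)⋯𝒢_k(u))Q_kᴴ`, `𝒢_k(u) = (Δ_a^{(k)} + uA₀^{(k)})⁻¹` — PART 261's
`towerLimitRate_word_at_coupling` on Bałaban's tower with the Neumann factors replaced by `2` and `‖u‖` by `T`; PART 261's `opNorm_conjMat_wordAt_le` through PART 126's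
dictionary; `decayRate_of_towerLimitRate`; (UD) = limit decay + the `DecayRate` clause at half the rate (PART 162 §3's bookkeeping). [our proof] -/
theorem couplingWordAt_decay_inputs (hL : 2 ≤ L) (hd : 1 ≤ d) {α₀ β₀ α₀' β₀' α β α' β' a' κ T : ℝ} (hα₀ : 0 ≤ α₀) (hβ₀ : 0 ≤ β₀) (hα₀' : 0 ≤ α₀') (hβ₀' : 0 ≤ β₀')
    (hα : 0 ≤ α) (hβ : 0 ≤ β) (hα' : 0 ≤ α') (hβ' : 0 ≤ β') (ha' : 0 < a') (hκ0 : 0 < κ)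
    (hγ' : Jfree d a' κ 1 < gammaPs d a') (hδ' : deltaK d a' κ 1 < sigma0 d a' ^ 2) (hJA : JA d a a' κ 1 < gamD d a) (hT0 : 0 ≤ T)
    (hT₁ : T * (2 * (d * (α₀ + β₀) * Cst d a) + α₀' * Cst d a) ≤ 1 / 2)
    (hT₂ : T * (d * (α₀ * G2 d a (max (JA d a a' κ 1) 0) (gamD d a - max (JA d a a' κ 1) 0) κ)
      + d * (Real.exp |κ| * (α₀ * G2 d a (max (JA d a a' κ 1) 0) (gamD d a - max (JA d a a' κ 1) 0) κ + β₀ * (gamD d a - max (JA d a a' κ 1) 0)⁻¹))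
      + α₀' * (gamD d a - max (JA d a a' κ 1) 0)⁻¹) ≤ 1 / 2)
    {σ : Type*} (w : List σ) :
    ∃ κ₁ B B' : ℝ, 0 < κ₁ ∧ 0 ≤ B ∧ 0 ≤ B' ∧ ∀ (M : Fin d → ℕ) [∀ μ, NeZero (M μ)]
      (U₁ U₂ : (k : ℕ) → Fin d → (idx L M k → ℂ)) (Z : (k : ℕ) → (idx L M k → ℂ))
      (V₁ V₂ : σ → (k : ℕ) → Fin d → (idx L M k → ℂ)) (W : σ → (k : ℕ) → (idx L M k → ℂ)),
      LipschitzBackground L M U₁ α₀ β₀ → LipschitzBackground L M U₂ α₀ β₀ → BoundedBackground L M Z α₀' β₀' →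
      (∀ i, LipschitzBackground L M (V₁ i) α β) → (∀ i, LipschitzBackground L M (V₂ i) α β) → (∀ i, BoundedBackground L M (W i) α' β') →
      ∀ (u : ℂ), ‖u‖ ≤ T →
      (∀ k, EntryDecay (distK L M) (avgTow (QBlev L M) ((L : ℝ) ^ d)
        (fun k => List.foldr (fun i N => (calDalev L M a ha k + u • (Pmodel L M U₁ k + (Pmodel L M U₂ k)ᴴ + Matrix.diagonal (Z k)))⁻¹
            * (Pmodel L M (V₁ i) k + (Pmodel L M (V₂ i) k)ᴴ + Matrix.diagonal (W i k)) * N)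
          (calDalev L M a ha k + u • (Pmodel L M U₁ k + (Pmodel L M U₂ k)ᴴ + Matrix.diagonal (Z k)))⁻¹ w) k) B κ₁) ∧
      TwoLevelDecayRate (distK L M) (avgTow (QBlev L M) ((L : ℝ) ^ d)
        (fun k => List.foldr (fun i N => (calDalev L M a ha k + u • (Pmodel L M U₁ k + (Pmodel L M U₂ k)ᴴ + Matrix.diagonal (Z k)))⁻¹
            * (Pmodel L M (V₁ i) k + (Pmodel L M (V₂ i) k)ᴴ + Matrix.diagonal (W i k)) * N)
          (calDalev L M a ha k + u • (Pmodel L M U₁ k + (Pmodel L M U₂ k)ᴴ + Matrix.diagonal (Z k)))⁻¹ w)) B' κ₁ (Real.sqrt ((L : ℝ)⁻¹)) := by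
  set J : ℝ := max (JA d a a' κ 1) 0 with hJdef
  have hJ0 : 0 ≤ J := le_max_right _ _
  have hJγ : J < gamD d a := max_JA_lt_gamD a hJA
  set κc₀ : ℝ := d * (α₀ * G2 d a J (gamD d a - J) κ) + d * (Real.exp |κ| * (α₀ * G2 d a J (gamD d a - J) κ + β₀ * (gamD d a - J)⁻¹)) + α₀' * (gamD d a - J)⁻¹ with hκc₀
  set κc : ℝ := d * (α * G2 d a J (gamD d a - J) κ) + d * (Real.exp |κ| * (α * G2 d a J (gamD d a - J) κ + β * (gamD d a - J)⁻¹)) + α' * (gamD d a - J)⁻¹ with hκc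
  set κ₀ : ℝ := 2 * (d * (α₀ + β₀) * Cst d a) + α₀' * Cst d a with hκ₀
  set κ' : ℝ := 2 * (d * (α + β) * Cst d a) + α' * Cst d a with hκ'
  set C2₀ : ℝ := C2model d L a α₀ β₀ + C2adj d L a α₀ β₀ + Cst d a * β₀' * Cst d a with hC2₀
  set C2 : ℝ := C2model d L a α β + C2adj d L a α β + Cst d a * β' * Cst d a with hC2
  have hCst := Cst_nonneg d a
  have hCJ := CJ_nonneg d a
  have hγi : 0 ≤ (gamD d a - J)⁻¹ := inv_nonneg.mpr (sub_pos.mpr hJγ).le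
  have hG2 : 0 ≤ G2 d a J (gamD d a - J) κ := G2_nonneg (d := d) a J (sub_pos.mpr hJγ) κ
  have hκ₀0 : 0 ≤ κ₀ := by positivity
  have hκ'0 : 0 ≤ κ' := by positivity
  have hκc₀0 : 0 ≤ κc₀ := by positivity
  have hκc0 : 0 ≤ κc := by positivity
  have hC2₀0 : 0 ≤ C2₀ := by
    have h1 : 0 ≤ C2model d L a α₀ β₀ := by unfold C2model; positivity
    have h2 := C2adj_nonneg d L a hα₀ hβ₀
    positivity
  have hC20 : 0 ≤ C2 := by
    have h1 : 0 ≤ C2model d L a α β := by unfold C2model; positivity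
    have h2 := C2adj_nonneg d L a hα hβ
    positivity
  -- the `u`-uniform constants (Neumann factors replaced by `2`, `‖u‖` by `T`)
  set CT : ℝ := ((w.length + 1) * (κ' * 2) ^ w.length * ((CJ d a + T * C2₀) * (2 : ℝ) ^ 2) + w.length * (κ' * 2) ^ (w.length - 1) * ((2 : ℝ) ^ 2 * C2))
    + (κ' * 2) ^ w.length * (2 * (2 * d * Cst d a) + 2 * (d * L * Cst d a * 2)) with hCT
  have hCT0 : 0 ≤ CT := by positivity
  set Bl : ℝ := (gamD d a - J)⁻¹ * 2 * (κc * 2) ^ w.length * Real.exp (κ * 4) with hBl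
  have hBl0 : 0 ≤ Bl := by positivity
  set R : ℝ := Real.sqrt (2 * Bl * (CT / (1 - (L : ℝ)⁻¹))) with hR
  set R' : ℝ := Real.sqrt (2 * Bl * (2 * CT / (1 - (L : ℝ)⁻¹))) with hR'
  have hL1 : (1 : ℝ) < L := by exact_mod_cast (lt_of_lt_of_le one_lt_two hL : 1 < L)
  have hρ0 : (0 : ℝ) ≤ (L : ℝ)⁻¹ := inv_nonneg.mpr (Nat.cast_nonneg _)
  have hρ1 : ((L : ℝ)⁻¹) < 1 := inv_lt_one_of_one_lt₀ hL1
  have hr : (0 : ℝ) < (L : ℝ) ^ d := pow_pos (lt_trans zero_lt_one hL1) d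
  have hθ0 : 0 ≤ Real.sqrt ((L : ℝ)⁻¹) := Real.sqrt_nonneg _
  have hθ1 : Real.sqrt ((L : ℝ)⁻¹) ≤ 1 := by rw [Real.sqrt_le_one]; exact inv_le_one_of_one_le₀ hL1.le
  refine ⟨κ / 2, Bl + R, R', half_pos hκ0, add_nonneg hBl0 (Real.sqrt_nonneg _), Real.sqrt_nonneg _,
    fun M _ U₁ U₂ Z V₁ V₂ W hU₁ hU₂ hZ hV₁ hV₂ hW u hu => ?_⟩
  -- Neumann factors on the disc
  obtain ⟨ht₀, hν0, hν⟩ := neumann_factor_le_two ((mul_le_mul_of_nonneg_right hu hκ₀0).trans hT₁)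
  obtain ⟨htc, hνc0, hνc⟩ := neumann_factor_le_two ((mul_le_mul_of_nonneg_right hu hκc₀0).trans hT₂)
  -- the rate half (PART 261 on Bałaban's tower), constant raised to `CT`
  have hT' := towerLimitRate_word_at_coupling hr (freeTowerLaws_balaban L M a ha) (perturbationLaws_couplingLetter L M a ha hd hU₁ hU₂ hZ)
    (fun i => perturbationLaws_couplingLetter L M a ha hd (hV₁ i) (hV₂ i) (hW i)) hκ'0 (fun k => mul_nonneg hC20 (pow_nonneg hρ0 k)) hρ1
    (fun k => le_rfl) (fun k => le_rfl) (fun k => le_rfl) (fun k => le_rfl) (fun k => le_rfl) ht₀ w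
  set ν : ℝ := (1 - ‖u‖ * κ₀)⁻¹ with hνdef
  have hx0 : 0 ≤ κ' * ν := mul_nonneg hκ'0 hν0
  have hx : κ' * ν ≤ κ' * 2 := mul_le_mul_of_nonneg_left hν hκ'0
  have hxn : (κ' * ν) ^ w.length ≤ (κ' * 2) ^ w.length := pow_le_pow_left₀ hx0 hx _
  have hxn1 : (κ' * ν) ^ (w.length - 1) ≤ (κ' * 2) ^ (w.length - 1) := pow_le_pow_left₀ hx0 hx _
  have hν2 : ν ^ 2 ≤ (2 : ℝ) ^ 2 := pow_le_pow_left₀ hν0 hν 2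
  have hA : CJ d a + ‖u‖ * C2₀ ≤ CJ d a + T * C2₀ := by
    have := mul_le_mul_of_nonneg_right hu hC2₀0; linarith
  have hle : ((w.length + 1) * (κ' * ν) ^ w.length * ((CJ d a + ‖u‖ * C2₀) * ν ^ 2)
        + w.length * (κ' * ν) ^ (w.length - 1) * (ν ^ 2 * C2))
      + (κ' * ν) ^ w.length * (ν * (2 * d * Cst d a) + 2 * (d * L * Cst d a * ν)) ≤ CT := by
    rw [hCT]
    refine add_le_add (add_le_add ?_ ?_) ?_
    · exact mul_le_mul (mul_le_mul_of_nonneg_left hxn (by positivity)) (mul_le_mul hA hν2 (by positivity) (by positivity)) (by positivity) (by positivity)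
    · exact mul_le_mul (mul_le_mul_of_nonneg_left hxn1 (by positivity)) (mul_le_mul_of_nonneg_right hν2 hC20) (by positivity) (by positivity)
    · exact mul_le_mul hxn (add_le_add (mul_le_mul_of_nonneg_right hν (by positivity)) (mul_le_mul_of_nonneg_left (mul_le_mul_of_nonneg_left hν (by positivity)) (by norm_num)))
        (by positivity) (by positivity)
  have hT := towerLimitRate_mono hT' hle hρ0 hρ1
  -- the decay half (PART 126's dictionary on PART 261's conjugated word bound at the base point)
  have hWc : ∀ (k : ℕ) (y : idx L M 0), WCoercive (calDalev L M a ha k) κ (rho L M k y) (gamD d a - J) :=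
    fun k y => wCoercive_calDa_of_conjDefect (lev L k) (one_le_lev' L k) M a ha (conjDefect_calDalev_rho L M a ha ha' hγ' hδ' k y)
  have hPc₀ : ∀ (k : ℕ) (y : idx L M 0),
      ‖conjMat κ (rho L M k y) (rho L M k y) (Pmodel L M U₁ k + (Pmodel L M U₂ k)ᴴ + Matrix.diagonal (Z k)) * conjMat κ (rho L M k y) (rho L M k y) (calDalev L M a ha k)⁻¹‖
        ≤ κc₀ :=
    fun k y => hPc_couplingLetter L M a ha hU₁ hU₂ hZ hJ0 hJγ k y (conjDefect_calDalev_rho L M a ha ha' hγ' hδ' k y)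
  have hPc : ∀ i (k : ℕ) (y : idx L M 0),
      ‖conjMat κ (rho L M k y) (rho L M k y) (Pmodel L M (V₁ i) k + (Pmodel L M (V₂ i) k)ᴴ + Matrix.diagonal (W i k))
        * conjMat κ (rho L M k y) (rho L M k y) (calDalev L M a ha k)⁻¹‖ ≤ κc :=
    fun i k y => hPc_couplingLetter L M a ha (hV₁ i) (hV₂ i) (hW i) hJ0 hJγ k y (conjDefect_calDalev_rho L M a ha ha' hγ' hδ' k y)
  have hdec : ∀ k, EntryDecay (distK L M) (avgTow (QBlev L M) ((L : ℝ) ^ d)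
      (fun k => List.foldr (fun i N => (calDalev L M a ha k + u • (Pmodel L M U₁ k + (Pmodel L M U₂ k)ᴴ + Matrix.diagonal (Z k)))⁻¹
          * (Pmodel L M (V₁ i) k + (Pmodel L M (V₂ i) k)ᴴ + Matrix.diagonal (W i k)) * N)
        (calDalev L M a ha k + u • (Pmodel L M U₁ k + (Pmodel L M U₂ k)ᴴ + Matrix.diagonal (Z k)))⁻¹ w) k) Bl κ := by
    intro k
    have h := hdecB_of_conjBound L M
      (X := fun k => List.foldr (fun i N => (calDalev L M a ha k + u • (Pmodel L M U₁ k + (Pmodel L M U₂ k)ᴴ + Matrix.diagonal (Z k)))⁻¹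
          * (Pmodel L M (V₁ i) k + (Pmodel L M (V₂ i) k)ᴴ + Matrix.diagonal (W i k)) * N)
        (calDalev L M a ha k + u • (Pmodel L M U₁ k + (Pmodel L M U₂ k)ᴴ + Matrix.diagonal (Z k)))⁻¹ w)
      hκ0.le (fun k y => opNorm_conjMat_wordAt_le (hWc k y) (sub_pos.mpr hJγ) hκc0 (hPc₀ k y) (fun i => hPc i k y) htc w) k
    refine h.mono ?_
    rw [hBl]
    have h2 : (κc * (1 - ‖u‖ * κc₀)⁻¹) ^ w.length ≤ (κc * 2) ^ w.length := pow_le_pow_left₀ (by positivity) (mul_le_mul_of_nonneg_left hνc hκc0) _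
    have h3 : (gamD d a - J)⁻¹ * (1 - ‖u‖ * κc₀)⁻¹ ≤ (gamD d a - J)⁻¹ * 2 := mul_le_mul_of_nonneg_left hνc hγi
    exact mul_le_mul_of_nonneg_right (mul_le_mul h3 h2 (by positivity) (by positivity)) (Real.exp_pos _).le
  obtain ⟨clim, -, hlim, hrate, hstep⟩ := decayRate_of_towerLimitRate hρ0 hρ1 hCT0 hT hdec
  refine ⟨fun k => ?_, fun k x y => (hstep k x y).trans (le_of_eq (by rw [hR']))⟩
  have h1 : EntryDecay (distK L M) clim Bl (κ / 2) := entryDecay_of_le_rate (distK_nonneg L M) hlim hBl0 (half_le_self hκ0.le)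
  have h2 : EntryDecay (distK L M) (avgTow (QBlev L M) ((L : ℝ) ^ d)
      (fun k => List.foldr (fun i N => (calDalev L M a ha k + u • (Pmodel L M U₁ k + (Pmodel L M U₂ k)ᴴ + Matrix.diagonal (Z k)))⁻¹
          * (Pmodel L M (V₁ i) k + (Pmodel L M (V₂ i) k)ᴴ + Matrix.diagonal (W i k)) * N)
        (calDalev L M a ha k + u • (Pmodel L M U₁ k + (Pmodel L M U₂ k)ᴴ + Matrix.diagonal (Z k)))⁻¹ w) k - clim) R (κ / 2) := by
    intro x y
    refine (hrate k x y).trans ?_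
    rw [hR]
    exact mul_le_mul_of_nonneg_right (mul_le_of_le_one_right (Real.sqrt_nonneg _) (pow_le_one₀ hθ0 hθ1)) (Real.exp_pos _).le
  have e2 : avgTow (QBlev L M) ((L : ℝ) ^ d)
      (fun k => List.foldr (fun i N => (calDalev L M a ha k + u • (Pmodel L M U₁ k + (Pmodel L M U₂ k)ᴴ + Matrix.diagonal (Z k)))⁻¹
          * (Pmodel L M (V₁ i) k + (Pmodel L M (V₂ i) k)ᴴ + Matrix.diagonal (W i k)) * N)
        (calDalev L M a ha k + u • (Pmodel L M U₁ k + (Pmodel L M U₂ k)ᴴ + Matrix.diagonal (Z k)))⁻¹ w) k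
      = clim + (avgTow (QBlev L M) ((L : ℝ) ^ d)
      (fun k => List.foldr (fun i N => (calDalev L M a ha k + u • (Pmodel L M U₁ k + (Pmodel L M U₂ k)ᴴ + Matrix.diagonal (Z k)))⁻¹
          * (Pmodel L M (V₁ i) k + (Pmodel L M (V₂ i) k)ᴴ + Matrix.diagonal (W i k)) * N)
        (calDalev L M a ha k + u • (Pmodel L M U₁ k + (Pmodel L M U₂ k)ᴴ + Matrix.diagonal (Z k)))⁻¹ w) k - clim) := by abel
  rw [e2]
  exact entryDecay_add h1 h2

end Summit.QuantumFields.BalabanUV.Beta.GAN24.CouplingWordsAtCouplingDecay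

end
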